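import Mathlib
import HarnessLib

/-!
# BED Ω, GLOBAL PATCH (g-b), F6 ALGEBRA: regular pairs `(∏ yᵢ^{aᵢ}, χ)` from TRANSVERSALITY — `χ` is a non-zero-divisor modulo `∏ yᵢ^{aᵢ}` as soon as each `B/(yᵢ)` is a domain
# not containing `χ̄ = 0` and each `yᵢ` is a non-zero-divisor (the stalk-level route to the 0BIQ charts of the cure, `g14/F6-DESIGN.md` option (i′): at a point of the refined
# class model the exceptional letters through it are regular parameters by ✓ `NewtonChartLemma.ishii_lemma_4_4_24`, so no per-cone primality of `(θ_σ, χ_σ)` is needed)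
# (crux `FInjectiveMacaulayfication` stmt-ResolutionOfSingularities-15315, chain w45a; seat res-L1-w45a-stub-3 g14)

[OURS · L1 W4.5a] Support file (`--supports stmt-ResolutionOfSingularities-15315 --as helper`); pure commutative algebra, theorems only, no named fact; NOT a statement of any
manuscript; nothing of the crux is proved. Convention (as in ✓p709719): «`v` is a non-zero-divisor modulo `u`» is spelled `∀ r, u ∣ r * v → u ∣ r`. AI-written (AI review is weaker
than expert review).
* `nzdMod_of_quotient_isDomain` — `B/(y)` a domain and `χ ∉ (y)` ⇒ `χ` is a nzd mod `y`; `nzdMod_mul` — nzd mod `y` and mod `z` (`y` a nzd) ⇒ nzd mod `y·z`; `nzdMod_pow`, ★ `nzdMod_prod_pow`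
  — hence mod `∏ yᵢ^{aᵢ}`; `nzdMod_unit_mul` — and mod `e·u` for a unit `e`.
[cite: Matsumura1987, Thm. 16.1 and §14 (regular sequences, systems of parameters)]
-/

set_option linter.dupNamespace false

namespace Summit.ResolutionOfSingularities.ResolutionOfSingularities.Theorems.FInjectiveMacaulayfication.RegularPairFromTransversal

variable {B : Type*} [CommRing B]

/-- If `B/(y)` is a domain and `χ ∉ (y)` then `χ` is a non-zero-divisor modulo `y`. [folklore] -/
theorem nzdMod_of_quotient_isDomain (y χ : B) [IsDomain (B ⧸ Ideal.span {y})] (hχ : χ ∉ Ideal.span {y}) : ∀ r : B, y ∣ r * χ → y ∣ r := by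
  intro r h
  have h1 : Ideal.Quotient.mk (Ideal.span {y}) r * Ideal.Quotient.mk (Ideal.span {y}) χ = 0 := by
    rw [← map_mul, Ideal.Quotient.eq_zero_iff_mem, Ideal.mem_span_singleton]; exact h
  rcases mul_eq_zero.mp h1 with h2 | h2
  · rw [Ideal.Quotient.eq_zero_iff_mem, Ideal.mem_span_singleton] at h2; exact h2
  · exact absurd (by rw [Ideal.Quotient.eq_zero_iff_mem] at h2; exact h2) hχ

/-- nzd modulo `y` and modulo `z`, with `y` a non-zero-divisor ⇒ nzd modulo `y·z`. [folklore] -/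
theorem nzdMod_mul {y z χ : B} (hy : y ∈ nonZeroDivisors B) (h1 : ∀ r : B, y ∣ r * χ → y ∣ r) (h2 : ∀ r : B, z ∣ r * χ → z ∣ r) :
    ∀ r : B, y * z ∣ r * χ → y * z ∣ r := by
  intro r h
  obtain ⟨r₁, rfl⟩ := h1 r (dvd_trans (dvd_mul_right y z) h)
  obtain ⟨c, hc⟩ := h
  have h3 : z ∣ r₁ * χ := ⟨c, by
    have h4 : y * (r₁ * χ) = y * (z * c) := by rw [← mul_assoc, hc]; ring
    exact (mul_cancel_left_mem_nonZeroDivisors hy).mp h4⟩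
  obtain ⟨r₂, rfl⟩ := h2 r₁ h3
  exact ⟨r₂, by ring⟩

/-- nzd modulo `y` (`y` a non-zero-divisor) ⇒ nzd modulo `y^a`. [folklore] -/
theorem nzdMod_pow {y χ : B} (hy : y ∈ nonZeroDivisors B) (h1 : ∀ r : B, y ∣ r * χ → y ∣ r) (a : ℕ) : ∀ r : B, y ^ a ∣ r * χ → y ^ a ∣ r := by
  induction a with
  | zero => intro r _; simp
  | succ a ih => rw [pow_succ']; exact nzdMod_mul hy h1 ih

/-- ★ nzd modulo each `yᵢ` (all non-zero-divisors) ⇒ nzd modulo `∏ᵢ yᵢ^{aᵢ}`. [folklore] -/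
theorem nzdMod_prod_pow {ι : Type*} (s : Finset ι) (y : ι → B) (a : ι → ℕ) (χ : B) (hy : ∀ i ∈ s, y i ∈ nonZeroDivisors B)
    (h : ∀ i ∈ s, ∀ r : B, y i ∣ r * χ → y i ∣ r) : ∀ r : B, (∏ i ∈ s, y i ^ a i) ∣ r * χ → (∏ i ∈ s, y i ^ a i) ∣ r := by
  classical
  induction s using Finset.induction_on with
  | empty => intro r _; simp
  | insert i s hi ih =>
    rw [Finset.prod_insert hi]
    exact nzdMod_mul (pow_mem (hy i (Finset.mem_insert_self i s)) _)
      (nzdMod_pow (hy i (Finset.mem_insert_self i s)) (h i (Finset.mem_insert_self i s)) (a i))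
      (ih (fun j hj => hy j (Finset.mem_insert_of_mem hj)) (fun j hj => h j (Finset.mem_insert_of_mem hj)))

/-- nzd modulo `u` ⇒ nzd modulo `e·u` for a unit `e`. [folklore] -/
theorem nzdMod_unit_mul {u χ : B} (e : B) (he : IsUnit e) (h : ∀ r : B, u ∣ r * χ → u ∣ r) : ∀ r : B, e * u ∣ r * χ → e * u ∣ r := by
  intro r hr
  have h1 : u ∣ r * χ := dvd_trans (dvd_mul_left u e) hr
  exact (he.mul_left_dvd).mpr (h r h1)

/-- A finite product of non-zero-divisors (with exponents) is a non-zero-divisor. [folklore] -/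
theorem prod_pow_mem_nonZeroDivisors {ι : Type*} (s : Finset ι) (y : ι → B) (a : ι → ℕ) (hy : ∀ i ∈ s, y i ∈ nonZeroDivisors B) :
    (∏ i ∈ s, y i ^ a i) ∈ nonZeroDivisors B := by
  classical
  induction s using Finset.induction_on with
  | empty => simp [one_mem]
  | insert i s hi ih =>
    rw [Finset.prod_insert hi]
    exact mul_mem (pow_mem (hy i (Finset.mem_insert_self i s)) _) (ih fun j hj => hy j (Finset.mem_insert_of_mem hj))

end Summit.ResolutionOfSingularities.ResolutionOfSingularities.Theorems.FInjectiveMacaulayfication.RegularPairFromTransversal
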